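import Summits.AtomisticToContinuum.FouriersLaw.Theses.EmbeddedDrudeMourre
import Summits.AtomisticToContinuum.FouriersLaw.Theorems.EmbeddedDrudeMourreDrudeDissolutionStubIntegrableSpectralCriterion
import Summits.AtomisticToContinuum.FouriersLaw.Theorems.EmbeddedDrudeMourreMourreDissolutionCosineBochner
import Literature.MathematicalPhysics.KineticTheory.ZeroWavenumberSpace
import Literature.MathematicalPhysics.KineticTheory.InfiniteChainPartialMomentumReversal
import Literature.MathematicalPhysics.KineticTheory.InfiniteChainSuperstableDynamics
import HarnessLib

/-!
# `DrudeDissolution` REDUCED to the zero-wavenumber framework and a kinetic Green–Kubo statement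
(`--supports` stmt-AtomisticToContinuum-12593; line `Sketch`, lead rev 3)

The crux `EmbeddedDrudeMourre.DrudeDissolution` (the route's target: for the low-temperature pinned
anharmonic chain, a DLR state with a preserving dynamics whose summed current autocorrelation `C_T` is
the cosine transform of a finite measure carrying a continuous positive density at frequency `0`) is
proved here CONDITIONALLY on the two registered open stubs of line `Sketch`, spelled out as hypotheses:

* (F) `ZeroWavenumberFramework` — for every `T > 0` a dynamics `D` with `D.carrier = bmGood` and a
  zero-wavenumber datum `Z : ZeroWavenumberData (pinnedChain …) D` (Doyon's `ℋ₀`) whose state is DLR at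
  `T`, with strongly continuous Koopman group (infrastructure; shared in substance with the registered
  framework stubs of the sibling cruxes MourreDissolution stmt-12594 and GreenKuboContinuation stmt-12597);
* (K) `KineticGreenKubo` — on a corner `T < T₀`, for every such `(D, Z)`, `C_T ∈ L¹(0,∞)` and
  `∫₀^∞ C_T > 0` (the open problem: finite positive Green–Kubo conductivity, = the content of
  `FourierGreenKubo.FourierGreenKubo` stmt-0703 / `KineticCorner.KineticCornerGreenKubo` (i) stmt-3429).

Everything else is PROVED: from `Z` the tree gives invariance (`Z.preservesMeasure`), absolute
convergence (`Z.hasAbsConvergentCorrelation`, the mean current of a DLR state vanishing by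
`IsChainGibbsMeasure.integral_bondCurrentZ_eq_zero`), `C_T(t) = ⟪[J], U_t[J]⟫₀` hence continuity,
evenness and real positive type (`regular_of_zeroWavenumberData` below); the landed
`Theorems.MourreDissolution.stub_cosineBochner` (Bochner) gives the spectral measure; (K) and the landed
`Theorems.DrudeDissolution.LineSketch.stub_integrableSpectralCriterion` (inversion theorem) give the
window. So `DrudeDissolution ⇐ (F) ∧ (K)`: the target of route EmbeddedDrudeMourre is implied by the
zero-wavenumber framework plus the Green–Kubo crux of the sibling routes on the kinetic corner.
-/

noncomputable section

open MeasureTheory Filter Set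
open scoped Topology InnerProductSpace

namespace Summit.AtomisticToContinuum.FouriersLaw.Theorems.DrudeDissolution.LineSketch

open Literature.MathematicalPhysics.KineticTheory.HeatConduction

/-- FRAMEWORK ⇒ REGULARITY (all from tree lemmas): for a zero-wavenumber datum `Z` over `D` whose state
is DLR at `T`, the pair `(Z.μ, D)` is a `Z.μ`-preserving dynamics with absolutely convergent summed
current correlations at every time, and — the Koopman group being strongly continuous — `C_T` is
continuous, even and of real positive type (`C_T(t) = ⟪[J], U_t [J]⟫₀`). [folklore] -/
theorem regular_of_zeroWavenumberData {ω₂ lam β γ T : ℝ}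
    {D : InfiniteChainDynamics (pinnedChain ω₂ lam β γ)}
    (Z : ZeroWavenumberData (pinnedChain ω₂ lam β γ) D)
    (hG : (pinnedChain ω₂ lam β γ).IsChainGibbsMeasure T Z.μ)
    (hsc : ∀ ψ : ZeroWavenumberSpace Z, Continuous fun t : ℝ => Z.koopman t ψ) :
    D.PreservesMeasure Z.μ ∧ (∀ t : ℝ, D.HasAbsConvergentCorrelation Z.μ t) ∧
      Continuous (D.currentCorrelation Z.μ) ∧
      (∀ t : ℝ, D.currentCorrelation Z.μ (-t) = D.currentCorrelation Z.μ t) ∧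
      (∀ (n : ℕ) (c τ : Fin n → ℝ),
        0 ≤ ∑ i, ∑ j, c i * c j * D.currentCorrelation Z.μ (τ j - τ i)) := by
  have hmean : ∫ σ, (pinnedChain ω₂ lam β γ).bondCurrentZ σ 0 ∂Z.μ = 0 :=
    hG.integral_bondCurrentZ_eq_zero 0
  have hrep : ∀ t : ℝ, D.currentCorrelation Z.μ t =
      @inner ℝ _ _ Z.currentClass (Z.koopman t Z.currentClass) :=
    fun t => (Z.inner_currentClass_koopman_eq_currentCorrelation hmean t).symm
  refine ⟨Z.preservesMeasure, fun t => Z.hasAbsConvergentCorrelation hmean t, ?_, ?_, ?_⟩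
  · have h : D.currentCorrelation Z.μ =
        fun t => @inner ℝ _ _ Z.currentClass (Z.koopman t Z.currentClass) :=
      funext hrep
    rw [h]
    exact continuous_const.inner (hsc Z.currentClass)
  · intro t
    rw [hrep, hrep, Z.inner_currentClass_koopman_neg]
  · intro n c τ
    simp only [hrep]
    exact Z.toFluctuationDynamics.sum_mul_inner_koopman_nonneg Finset.univ c τ Z.currentClass

/-- **`DrudeDissolution ⇐ ZeroWavenumberFramework ∧ KineticGreenKubo`** (the checked composition of line
`Sketch`, rev 3, with its two open stubs as explicit hypotheses; both hypotheses are the registered stub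
signatures verbatim). For `pinnedChain ω₂ lam β γ` (all `> 0`): IF for every `T > 0` there are a
dynamics `D` with `D.carrier = bmGood` and a zero-wavenumber datum `Z` over `D` whose state is DLR at `T`
with strongly continuous Koopman group, AND on some corner `T < T₀` every such `(D, Z)` has
`C_T ∈ L¹(0,∞)` with `∫₀^∞ C_T > 0`, THEN the dissolved-Drude-atom statement holds (with the same `T₀`,
the witness `(Z.μ, D)`, the Bochner measure of `C_T` symmetrised and inverted). [folklore] -/
theorem drudeDissolution_of_framework_of_kineticGreenKubo :
    (∀ ω₂ lam β γ : ℝ, 0 < ω₂ → 0 < lam → 0 < β → 0 < γ → ∀ T : ℝ, 0 < T →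
      ∃ (D : Literature.MathematicalPhysics.KineticTheory.HeatConduction.InfiniteChainDynamics
            (Literature.MathematicalPhysics.KineticTheory.HeatConduction.pinnedChain ω₂ lam β γ))
        (Z : Literature.MathematicalPhysics.KineticTheory.HeatConduction.ZeroWavenumberData
            (Literature.MathematicalPhysics.KineticTheory.HeatConduction.pinnedChain ω₂ lam β γ) D),
        D.carrier =
          (Literature.MathematicalPhysics.KineticTheory.HeatConduction.pinnedChain ω₂ lam β γ).bmGood ∧
        (Literature.MathematicalPhysics.KineticTheory.HeatConduction.pinnedChain
            ω₂ lam β γ).IsChainGibbsMeasure T Z.μ ∧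
        (∀ ψ : Literature.MathematicalPhysics.KineticTheory.HeatConduction.ZeroWavenumberSpace Z,
          Continuous fun t : ℝ => Z.koopman t ψ)) →
    (∀ ω₂ lam β γ : ℝ, 0 < ω₂ → 0 < lam → 0 < β → 0 < γ → ∃ T₀ : ℝ, 0 < T₀ ∧
      ∀ T : ℝ, 0 < T → T < T₀ →
        ∀ (D : Literature.MathematicalPhysics.KineticTheory.HeatConduction.InfiniteChainDynamics
              (Literature.MathematicalPhysics.KineticTheory.HeatConduction.pinnedChain ω₂ lam β γ))
          (Z : Literature.MathematicalPhysics.KineticTheory.HeatConduction.ZeroWavenumberData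
              (Literature.MathematicalPhysics.KineticTheory.HeatConduction.pinnedChain ω₂ lam β γ) D),
          D.carrier =
            (Literature.MathematicalPhysics.KineticTheory.HeatConduction.pinnedChain ω₂ lam β γ).bmGood →
          (Literature.MathematicalPhysics.KineticTheory.HeatConduction.pinnedChain
              ω₂ lam β γ).IsChainGibbsMeasure T Z.μ →
          MeasureTheory.IntegrableOn (D.currentCorrelation Z.μ) (Set.Ioi 0) ∧
            0 < ∫ t in Set.Ioi (0 : ℝ), D.currentCorrelation Z.μ t) →
    Summit.AtomisticToContinuum.FouriersLaw.Theses.EmbeddedDrudeMourre.DrudeDissolution := by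
  intro hF hK ω₂ lam β γ hω hl hβ hγ
  obtain ⟨T₀, hT₀, hK'⟩ := hK ω₂ lam β γ hω hl hβ hγ
  refine ⟨T₀, hT₀, fun T hTpos hTlt => ?_⟩
  obtain ⟨D, Z, hcar, hG, hsc⟩ := hF ω₂ lam β γ hω hl hβ hγ T hTpos
  obtain ⟨hP, hA, hcont, heven, hpsd⟩ := regular_of_zeroWavenumberData Z hG hsc
  obtain ⟨hint, hpos⟩ := hK' T hTpos hTlt D Z hcar hG
  obtain ⟨σ, hσ, hC⟩ := Theorems.MourreDissolution.stub_cosineBochner _ hcont heven hpsd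
  obtain ⟨σ', hσ', hC', δ, g, hδ, hg, hg0, hgpos, hres⟩ :=
    stub_integrableSpectralCriterion σ _ hσ hC hint hpos
  exact ⟨Z.μ, D, hG, hP, hA, σ', hσ', hC', δ, g, hδ, hg, hg0, hgpos, hres⟩

end Summit.AtomisticToContinuum.FouriersLaw.Theorems.DrudeDissolution.LineSketch

end
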